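import Summits.FinalStateConjecture.FinalStateConjecture.Theorems.ZeroEnergyKerrOrBombHawkingExtensionIsKerrNHGaussNullPrep
import Literature.Geometry.Lorentzian.IsometryProofs
import HarnessLib

/-!
# Crux `HawkingExtensionIsKerr` (stmt-FinalStateConjecture-17840), line `SketchIdeator2` —
# programme NH: the null Gauss equation on a coordinate pair (`stub_nh_gaussNullFrame`)

Lead c5.  For a smooth spacelike immersion of CODIMENSION TWO, an ambient field `K` differentiable
at `f y₀`, normal to `df` near `y₀`, null at `f y₀`, a null `N₀ ⊥ df(T_{y₀} N)` with
`g(K, N₀) ≠ 0`, and `g(∇_{df v} K, df w) = 0` at `y₀` (a `K`-valued, NULL second fundamental form):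
`(f^*g)(R(∂ᵢ,∂ⱼ)∂ⱼ, ∂ᵢ) = g(R̄(df ∂ᵢ, df ∂ⱼ)df ∂ⱼ, df ∂ᵢ)` (O'Neill 1983, Ch. 4, Thm. 5).  Proof: the
tree's `gauss_equation_localFrame` verbatim with the null-pair lemmas of `…NHGaussNullPrep.lean`.
-/

noncomputable section

set_option linter.dupNamespace false

namespace Summit.FinalStateConjecture.FinalStateConjecture.Theorems.HawkingExtensionIsKerr.SketchIdeator2

open Set Filter Bundle Function Manifold Literature.Geometry.Lorentzian
open Literature.Geometry.Lorentzian.PseudoRiemannianMetric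
open scoped Manifold ContDiff Topology

variable {E : Type*} [NormedAddCommGroup E] [NormedSpace ℝ E] {H : Type*} [TopologicalSpace H]
  {I : ModelWithCorners ℝ E H} {M : Type*} [TopologicalSpace M] [ChartedSpace H M]
  [IsManifold I ∞ M]

section Gauss

variable [FiniteDimensional ℝ E] [CompleteSpace E]
  (g : PseudoRiemannianMetric I ∞ E (TangentSpace I : M → Type _)) [g.HasLeviCivita]
  {E' : Type*} [NormedAddCommGroup E'] [NormedSpace ℝ E'] {H' : Type*} [TopologicalSpace H']
  {I' : ModelWithCorners ℝ E' H'} {N : Type*} [TopologicalSpace N] [ChartedSpace H' N]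
  [IsManifold I' ∞ N] [FiniteDimensional ℝ E'] [CompleteSpace E'] [I'.Boundaryless] {f : N → M}
  (hpb : PseudoRiemannianMetric.contMDiff_pullbackBilin I M I' N ∞)
  (hfi : g.IsSpacelikeImmersion I' f) {K : Π x : M, TangentSpace I x}
  {ι : Type*} [Fintype ι] [DecidableEq ι] (b' : Module.Basis ι ℝ E') {y₀ : N}
  {N₀ : TangentSpace I (f y₀)}

set_option maxHeartbeats 3200000 in
/-- **The null Gauss equation on a coordinate pair** (module docstring; O'Neill 1983, Ch. 4,
Thm. 5 with a `K`-valued, hence null, second fundamental form). -/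
theorem gauss_equation_null_localFrame
    (hK : MDiffAt (T% K) (f y₀))
    (hn : ∀ᶠ y in 𝓝 y₀, ∀ u : TangentSpace I' y, g.val (f y) (K (f y)) (mfderiv I' I f y u) = 0)
    (hKK : g.val (f y₀) (K (f y₀)) (K (f y₀)) = 0) (hNN : g.val (f y₀) N₀ N₀ = 0)
    (hKN : g.val (f y₀) (K (f y₀)) N₀ ≠ 0)
    (hNorm0 : ∀ u : TangentSpace I' y₀, g.val (f y₀) N₀ (mfderiv I' I f y₀ u) = 0)
    (hsff : ∀ v w : TangentSpace I' y₀,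
      g.val (f y₀) (g.leviCivita K (f y₀) (mfderiv I' I f y₀ v)) (mfderiv I' I f y₀ w) = 0)
    (hdim : Module.finrank ℝ E = Module.finrank ℝ E' + 2) (i j : ι) :
    haveI := (g.inducedMetric f hpb hfi).hasLeviCivita
    (g.inducedMetric f hpb hfi).val y₀ ((g.inducedMetric f hpb hfi).riemann y₀ ((trivializationAt
        E' (TangentSpace I') y₀).localFrame b' i (y₀)) ((trivializationAt E' (TangentSpace I')
        y₀).localFrame b' j (y₀)) ((trivializationAt E' (TangentSpace I') y₀).localFrame b' j
        (y₀))) ((trivializationAt E' (TangentSpace I') y₀).localFrame b' i (y₀)) =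
      g.val (f y₀) (g.riemann (f y₀) (mfderiv I' I f (y₀) ((trivializationAt E' (TangentSpace I')
          y₀).localFrame b' i (y₀))) (mfderiv I' I f (y₀) ((trivializationAt E' (TangentSpace I')
          y₀).localFrame b' j (y₀)))
        (mfderiv I' I f (y₀) ((trivializationAt E' (TangentSpace I') y₀).localFrame b' j (y₀))))
            (mfderiv I' I f (y₀) ((trivializationAt E' (TangentSpace I') y₀).localFrame b' i (y₀)))
            := by
  haveI := (g.inducedMetric f hpb hfi).hasLeviCivita
  have hf : ContMDiff I' I ∞ f := PseudoRiemannianMetric.IsSpacelikeImmersion.contMDiff_self hfi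
  have hf2 : ContMDiff I' I 2 f := hf.of_le (by exact WithTop.coe_le_coe.2 le_top)
  have hfd : ∀ z, MDifferentiableAt I' I f z := hf2.mdifferentiable two_ne_zero
  have hcovM : g.leviCivita.IsLocallyContMDiff 1 :=
    g.isLocallyContMDiff_leviCivita_holds 1 (by exact_mod_cast le_top)
  have hcovN : (g.inducedMetric f hpb hfi).leviCivita.IsLocallyContMDiff 1 :=
    (g.inducedMetric f hpb hfi).isLocallyContMDiff_leviCivita_holds 1 (by exact_mod_cast le_top)
  have hcompatM := (PseudoRiemannianMetric.isLeviCivita_leviCivita_holds (g := g)).2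
  have hcompatN := (PseudoRiemannianMetric.isLeviCivita_leviCivita_holds (g := (g.inducedMetric f
      hpb hfi))).2
  have hy₀ : y₀ ∈ (chartAt H' y₀).source := mem_chart_source H' y₀
  have hz : (extChartAt I' y₀) y₀ ∈ (extChartAt I' y₀).target := mem_extChartAt_target y₀
  have hz00 : (extChartAt I' y₀) y₀ + (0 : ℝ) • b' i + (0 : ℝ) • b' j ∈ (extChartAt I' y₀).target
      := by
    simp only [zero_smul, add_zero]; exact hz
  have hq : (extChartAt I' y₀).symm ((extChartAt I' y₀) y₀ + (0 : ℝ) • b' i + (0 : ℝ) • b' j) = y₀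
      := by
    rw [zero_smul, zero_smul, add_zero, add_zero]; exact extChartAt_to_inv y₀
  have hq₁ : (extChartAt I' y₀).symm ((extChartAt I' y₀) y₀ + (0 : ℝ) • b' i + (0 : ℝ) • b' j) ∈
      (chartAt H' y₀).source := by rw [hq]; exact hy₀
  have hq₁e : (extChartAt I' y₀).symm ((extChartAt I' y₀) y₀ + (0 : ℝ) • b' i + (0 : ℝ) • b' j) ∈
      (trivializationAt E' (TangentSpace I') y₀).baseSet := by
    rw [TangentBundle.trivializationAt_baseSet]; exact hq₁
  have hI'1 : IsManifold I' (1 + 1) N := inferInstanceAs (IsManifold I' 2 N)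
  have hI'2 : IsManifold I' (2 + 1) N := inferInstanceAs (IsManifold I' 3 N)
  have hVB1 : ContMDiffVectorBundle 1 E' (TangentSpace I' : N → Type _) I' :=
    TangentBundle.contMDiffVectorBundle
  have hVB2 : ContMDiffVectorBundle 2 E' (TangentSpace I' : N → Type _) I' :=
    TangentBundle.contMDiffVectorBundle
  have hx2 : ContMDiffAt (𝓘(ℝ, ℝ).prod 𝓘(ℝ, ℝ)) I' 2
      (uncurry fun t s : ℝ ↦ (extChartAt I' y₀).symm ((extChartAt I' y₀) y₀ + t • b' i + s • b' j))
          (0, 0) :=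
    (contMDiffAt_chartRect hz (b' i) (b' j)).of_le (by exact WithTop.coe_le_coe.2 le_top)
  have hF2 : ContMDiffAt (𝓘(ℝ, ℝ).prod 𝓘(ℝ, ℝ)) I 2
      (uncurry fun t s : ℝ ↦ f ((extChartAt I' y₀).symm ((extChartAt I' y₀) y₀ + t • b' i + s • b'
          j))) (0, 0) := hf2.contMDiffAt.comp (0, 0) hx2
  have hSj2 : CMDiffAt 2 (T% ((trivializationAt E' (TangentSpace I') y₀).localFrame b' j))
      ((extChartAt I' y₀).symm ((extChartAt I' y₀) y₀ + (0 : ℝ) • b' i + (0 : ℝ) • b' j)) :=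
    contMDiffAt_localFrame_of_mem 2 _ b' j hq₁e
  have hZN2 : ContMDiffAt (𝓘(ℝ, ℝ).prod 𝓘(ℝ, ℝ)) I'.tangent 2
      (fun q : ℝ × ℝ ↦ (TotalSpace.mk' E' ((extChartAt I' y₀).symm ((extChartAt I' y₀) y₀ + q.1 •
          b' i + q.2 • b' j))
        ((trivializationAt E' (TangentSpace I') y₀).localFrame b' j ((extChartAt I' y₀).symm
            ((extChartAt I' y₀) y₀ + q.1 • b' i + q.2 • b' j))) : TangentBundle I' N)) (0, 0) :=
    hSj2.comp (0, 0) hx2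
  have hZM2 : ContMDiffAt (𝓘(ℝ, ℝ).prod 𝓘(ℝ, ℝ)) I.tangent 2
      (fun q : ℝ × ℝ ↦ (TotalSpace.mk' E (f ((extChartAt I' y₀).symm ((extChartAt I' y₀) y₀ + q.1 •
          b' i + q.2 • b' j)))
        (mfderiv I' I f ((extChartAt I' y₀).symm ((extChartAt I' y₀) y₀ + q.1 • b' i + q.2 • b' j))
            ((trivializationAt E' (TangentSpace I') y₀).localFrame b' j ((extChartAt I' y₀).symm
            ((extChartAt I' y₀) y₀ + q.1 • b' i + q.2 • b' j)))) : TangentBundle I M)) (0, 0) :=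
    ((hf.contMDiff_tangentMap le_rfl).contMDiffAt.of_le
      (by exact WithTop.coe_le_coe.2 le_top)).comp (0, 0) hZN2
  have hM0 := covariantDerivAlong_covariantDerivAlong_sub_eq_curvature g.leviCivita hcovM
    (x := fun t s : ℝ ↦ f ((extChartAt I' y₀).symm ((extChartAt I' y₀) y₀ + t • b' i + s • b' j)))
    (Z := fun t s : ℝ ↦ mfderiv I' I f ((extChartAt I' y₀).symm ((extChartAt I' y₀) y₀ + t • b' i +
        s • b' j)) ((trivializationAt E' (TangentSpace I') y₀).localFrame b' j ((extChartAt I'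
        y₀).symm ((extChartAt I' y₀) y₀ + t • b' i + s • b' j)))) (t := 0) (s := 0) hF2 hZM2
  have hN0 := covariantDerivAlong_covariantDerivAlong_sub_eq_curvature (g.inducedMetric f hpb
      hfi).leviCivita hcovN
    (x := fun t s : ℝ ↦ (extChartAt I' y₀).symm ((extChartAt I' y₀) y₀ + t • b' i + s • b' j))
    (Z := fun t s : ℝ ↦ (trivializationAt E' (TangentSpace I') y₀).localFrame b' j ((extChartAt I'
        y₀).symm ((extChartAt I' y₀) y₀ + t • b' i + s • b' j))) (t := 0) (s := 0) hx2 hZN2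
  have hℓi : HasDerivAt (fun t : ℝ ↦ (extChartAt I' y₀) y₀ + t • b' i + (0 : ℝ) • b' j) (b' i) 0 :=
      by
    simpa using (((hasDerivAt_id (0 : ℝ)).smul_const (b' i)).const_add ((extChartAt I' y₀)
        y₀)).add_const ((0 : ℝ) • b' j)
  have hℓj : HasDerivAt (fun s : ℝ ↦ (extChartAt I' y₀) y₀ + (0 : ℝ) • b' i + s • b' j) (b' j) 0 :=
      by
    simpa using ((hasDerivAt_id (0 : ℝ)).smul_const (b' j)).const_add ((extChartAt I' y₀) y₀ + (0 :
        ℝ) • b' i)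
  rw [velocity_comp_symm_comp₀ b' (ℓ := fun t : ℝ ↦ (extChartAt I' y₀) y₀ + t • b' i + (0 : ℝ) • b'
      j) hz00 hℓi (hfd _),
    velocity_comp_symm_comp₀ b' (ℓ := fun s : ℝ ↦ (extChartAt I' y₀) y₀ + (0 : ℝ) • b' i + s • b'
        j) hz00 hℓj (hfd _),
    sum_coord_basis_smul, sum_coord_basis_smul] at hM0
  rw [velocity_symm_comp₀ b' (ℓ := fun t : ℝ ↦ (extChartAt I' y₀) y₀ + t • b' i + (0 : ℝ) • b' j)
      hz00 hℓi,
    velocity_symm_comp₀ b' (ℓ := fun s : ℝ ↦ (extChartAt I' y₀) y₀ + (0 : ℝ) • b' i + s • b' j)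
        hz00 hℓj,
    sum_coord_basis_smul, sum_coord_basis_smul] at hN0
  have hM := congrArg (fun v ↦ g.val (f ((extChartAt I' y₀).symm ((extChartAt I' y₀) y₀ + (0 : ℝ) •
      b' i + (0 : ℝ) • b' j))) v (mfderiv I' I f ((extChartAt I' y₀).symm ((extChartAt I' y₀) y₀ +
      (0 : ℝ) • b' i + (0 : ℝ) • b' j)) ((trivializationAt E' (TangentSpace I') y₀).localFrame b' i
      ((extChartAt I' y₀).symm ((extChartAt I' y₀) y₀ + (0 : ℝ) • b' i + (0 : ℝ) • b' j))))) hM0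
  have hN := congrArg (fun v ↦ (g.inducedMetric f hpb hfi).val ((extChartAt I' y₀).symm
      ((extChartAt I' y₀) y₀ + (0 : ℝ) • b' i + (0 : ℝ) • b' j)) v ((trivializationAt E'
      (TangentSpace I') y₀).localFrame b' i ((extChartAt I' y₀).symm ((extChartAt I' y₀) y₀ + (0 :
      ℝ) • b' i + (0 : ℝ) • b' j)))) hN0
  simp only [map_sub, _root_.sub_apply] at hM hN
  have hVlift := mdifferentiableAt_lift_covariantDerivAlong_curry_right g.leviCivita hcovM
    (x := fun t s : ℝ ↦ f ((extChartAt I' y₀).symm ((extChartAt I' y₀) y₀ + t • b' i + s • b' j)))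
        (Z := fun t s : ℝ ↦ mfderiv I' I f ((extChartAt I' y₀).symm ((extChartAt I' y₀) y₀ + t • b'
        i + s • b' j)) ((trivializationAt E' (TangentSpace I') y₀).localFrame b' j ((extChartAt I'
        y₀).symm ((extChartAt I' y₀) y₀ + t • b' i + s • b' j)))) (t := 0) (s := 0) hF2 hZM2
  have hVBlift := mdifferentiableAt_lift_covariantDerivAlong_curry_left g.leviCivita hcovM
    (x := fun t s : ℝ ↦ f ((extChartAt I' y₀).symm ((extChartAt I' y₀) y₀ + t • b' i + s • b' j)))
        (Z := fun t s : ℝ ↦ mfderiv I' I f ((extChartAt I' y₀).symm ((extChartAt I' y₀) y₀ + t • b'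
        i + s • b' j)) ((trivializationAt E' (TangentSpace I') y₀).localFrame b' j ((extChartAt I'
        y₀).symm ((extChartAt I' y₀) y₀ + t • b' i + s • b' j)))) (t := 0) (s := 0) hF2 hZM2
  have hVNlift := mdifferentiableAt_lift_covariantDerivAlong_curry_right (g.inducedMetric f hpb
      hfi).leviCivita hcovN
    (x := fun t s : ℝ ↦ (extChartAt I' y₀).symm ((extChartAt I' y₀) y₀ + t • b' i + s • b' j)) (Z
        := fun t s : ℝ ↦ (trivializationAt E' (TangentSpace I') y₀).localFrame b' j ((extChartAt I'
        y₀).symm ((extChartAt I' y₀) y₀ + t • b' i + s • b' j))) (t := 0) (s := 0) hx2 hZN2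
  have hVBNlift := mdifferentiableAt_lift_covariantDerivAlong_curry_left (g.inducedMetric f hpb
      hfi).leviCivita hcovN
    (x := fun t s : ℝ ↦ (extChartAt I' y₀).symm ((extChartAt I' y₀) y₀ + t • b' i + s • b' j)) (Z
        := fun t s : ℝ ↦ (trivializationAt E' (TangentSpace I') y₀).localFrame b' j ((extChartAt I'
        y₀).symm ((extChartAt I' y₀) y₀ + t • b' i + s • b' j))) (t := 0) (s := 0) hx2 hZN2
  have hci : MDifferentiableAt 𝓘(ℝ, ℝ) I' (fun t : ℝ ↦ (extChartAt I' y₀).symm ((extChartAt I' y₀)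
      y₀ + t • b' i + (0 : ℝ) • b' j)) 0 :=
    mdifferentiableAt_curry_left hx2 two_ne_zero
  have hcj : MDifferentiableAt 𝓘(ℝ, ℝ) I' (fun s : ℝ ↦ (extChartAt I' y₀).symm ((extChartAt I' y₀)
      y₀ + (0 : ℝ) • b' i + s • b' j)) 0 :=
    mdifferentiableAt_curry_right hx2 two_ne_zero
  have hSi1 : ∀ t s : ℝ, ∀ a, MDiffAt (T% ((trivializationAt E' (TangentSpace I') y₀).localFrame b'
      a)) ((fun t s : ℝ ↦ (extChartAt I' y₀).symm ((extChartAt I' y₀) y₀ + t • b' i + s • b' j)) t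
      s) →
      MDifferentiableAt I' I.tangent (fun z ↦ (TotalSpace.mk' E (f z)
        (mfderiv I' I f (z) ((trivializationAt E' (TangentSpace I') y₀).localFrame b' a (z))) :
            TangentBundle I M)) ((fun t s : ℝ ↦ (extChartAt I' y₀).symm ((extChartAt I' y₀) y₀ + t
            • b' i + s • b' j)) t s) :=
    fun t s a h ↦ mdifferentiableAt_lift_mfderiv hf2 h
  have hSq : ∀ a, MDiffAt (T% ((trivializationAt E' (TangentSpace I') y₀).localFrame b' a))
      ((extChartAt I' y₀).symm ((extChartAt I' y₀) y₀ + (0 : ℝ) • b' i + (0 : ℝ) • b' j)) := fun a ↦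
    (contMDiffAt_localFrame_of_mem 1 _ b' a hq₁e).mdifferentiableAt one_ne_zero
  have hWlift : MDifferentiableAt 𝓘(ℝ, ℝ) I.tangent (fun t : ℝ ↦ (TotalSpace.mk' E
      (f ((extChartAt I' y₀).symm ((extChartAt I' y₀) y₀ + t • b' i + (0 : ℝ) • b' j))) (mfderiv I'
          I f ((extChartAt I' y₀).symm ((extChartAt I' y₀) y₀ + t • b' i + (0 : ℝ) • b' j))
          ((trivializationAt E' (TangentSpace I') y₀).localFrame b' i ((extChartAt I' y₀).symm
          ((extChartAt I' y₀) y₀ + t • b' i + (0 : ℝ) • b' j)))) : TangentBundle I M)) 0 :=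
    mdifferentiableAt_lift_comp_curve (I := I) (f := f) (c := fun t : ℝ ↦ (extChartAt I' y₀).symm
        ((extChartAt I' y₀) y₀ + t • b' i + (0 : ℝ) • b' j))
      (Y := fun z ↦ mfderiv I' I f (z) ((trivializationAt E' (TangentSpace I') y₀).localFrame b' i
          (z))) hci (hSi1 0 0 i (hSq i))
  have hWBlift : MDifferentiableAt 𝓘(ℝ, ℝ) I.tangent (fun s : ℝ ↦ (TotalSpace.mk' E
      (f ((extChartAt I' y₀).symm ((extChartAt I' y₀) y₀ + (0 : ℝ) • b' i + s • b' j))) (mfderiv I'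
          I f ((extChartAt I' y₀).symm ((extChartAt I' y₀) y₀ + (0 : ℝ) • b' i + s • b' j))
          ((trivializationAt E' (TangentSpace I') y₀).localFrame b' i ((extChartAt I' y₀).symm
          ((extChartAt I' y₀) y₀ + (0 : ℝ) • b' i + s • b' j)))) : TangentBundle I M)) 0 :=
    mdifferentiableAt_lift_comp_curve (I := I) (f := f) (c := fun s : ℝ ↦ (extChartAt I' y₀).symm
        ((extChartAt I' y₀) y₀ + (0 : ℝ) • b' i + s • b' j))
      (Y := fun z ↦ mfderiv I' I f (z) ((trivializationAt E' (TangentSpace I') y₀).localFrame b' i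
          (z))) hcj (hSi1 0 0 i (hSq i))
  have hWNlift : MDiffAt (T% ((trivializationAt E' (TangentSpace I') y₀).localFrame b' i)) ((fun t
      : ℝ ↦ (extChartAt I' y₀).symm ((extChartAt I' y₀) y₀ + t • b' i + (0 : ℝ) • b' j)) 0) := hSq i
  have hWBNlift : MDiffAt (T% ((trivializationAt E' (TangentSpace I') y₀).localFrame b' i)) ((fun s
      : ℝ ↦ (extChartAt I' y₀).symm ((extChartAt I' y₀) y₀ + (0 : ℝ) • b' i + s • b' j)) 0) := hSq i
  have hA := (g.hasDerivAt_val_apply_along hcompatM (γ := fun t : ℝ ↦ f ((extChartAt I' y₀).symm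
      ((extChartAt I' y₀) y₀ + t • b' i + (0 : ℝ) • b' j)))
    (V := fun t : ℝ ↦ covariantDerivAlong g.leviCivita (fun s : ℝ ↦ f ((extChartAt I' y₀).symm
        ((extChartAt I' y₀) y₀ + t • b' i + s • b' j))) (fun s ↦ mfderiv I' I f ((extChartAt I'
        y₀).symm ((extChartAt I' y₀) y₀ + t • b' i + s • b' j)) ((trivializationAt E' (TangentSpace
        I') y₀).localFrame b' j ((extChartAt I' y₀).symm ((extChartAt I' y₀) y₀ + t • b' i + s • b'
        j)))) 0) (W := fun t : ℝ ↦ mfderiv I' I f ((extChartAt I' y₀).symm ((extChartAt I' y₀) y₀ +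
        t • b' i + (0 : ℝ) • b' j)) ((trivializationAt E' (TangentSpace I') y₀).localFrame b' i
        ((extChartAt I' y₀).symm ((extChartAt I' y₀) y₀ + t • b' i + (0 : ℝ) • b' j)))) (t₀ := 0)
        hVlift hWlift).deriv
  have hB := (g.hasDerivAt_val_apply_along hcompatM (γ := fun s : ℝ ↦ f ((extChartAt I' y₀).symm
      ((extChartAt I' y₀) y₀ + (0 : ℝ) • b' i + s • b' j)))
    (V := fun s : ℝ ↦ covariantDerivAlong g.leviCivita (fun t : ℝ ↦ f ((extChartAt I' y₀).symm
        ((extChartAt I' y₀) y₀ + t • b' i + s • b' j))) (fun t ↦ mfderiv I' I f ((extChartAt I'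
        y₀).symm ((extChartAt I' y₀) y₀ + t • b' i + s • b' j)) ((trivializationAt E' (TangentSpace
        I') y₀).localFrame b' j ((extChartAt I' y₀).symm ((extChartAt I' y₀) y₀ + t • b' i + s • b'
        j)))) 0) (W := fun s : ℝ ↦ mfderiv I' I f ((extChartAt I' y₀).symm ((extChartAt I' y₀) y₀ +
        (0 : ℝ) • b' i + s • b' j)) ((trivializationAt E' (TangentSpace I') y₀).localFrame b' i
        ((extChartAt I' y₀).symm ((extChartAt I' y₀) y₀ + (0 : ℝ) • b' i + s • b' j)))) (t₀ := 0)
        hVBlift hWBlift).deriv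
  have hAN := ((g.inducedMetric f hpb hfi).hasDerivAt_val_apply_along hcompatN (γ := fun t : ℝ ↦
      (extChartAt I' y₀).symm ((extChartAt I' y₀) y₀ + t • b' i + (0 : ℝ) • b' j))
    (V := fun t : ℝ ↦ covariantDerivAlong (g.inducedMetric f hpb hfi).leviCivita (fun s : ℝ ↦
        (extChartAt I' y₀).symm ((extChartAt I' y₀) y₀ + t • b' i + s • b' j)) (fun s ↦
        (trivializationAt E' (TangentSpace I') y₀).localFrame b' j ((extChartAt I' y₀).symm
        ((extChartAt I' y₀) y₀ + t • b' i + s • b' j))) 0) (W := fun t : ℝ ↦ (trivializationAt E'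
        (TangentSpace I') y₀).localFrame b' i ((extChartAt I' y₀).symm ((extChartAt I' y₀) y₀ + t •
        b' i + (0 : ℝ) • b' j))) (t₀ := 0) hVNlift ((hWNlift).comp 0 hci)).deriv
  have hBN := ((g.inducedMetric f hpb hfi).hasDerivAt_val_apply_along hcompatN (γ := fun s : ℝ ↦
      (extChartAt I' y₀).symm ((extChartAt I' y₀) y₀ + (0 : ℝ) • b' i + s • b' j))
    (V := fun s : ℝ ↦ covariantDerivAlong (g.inducedMetric f hpb hfi).leviCivita (fun t : ℝ ↦
        (extChartAt I' y₀).symm ((extChartAt I' y₀) y₀ + t • b' i + s • b' j)) (fun t ↦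
        (trivializationAt E' (TangentSpace I') y₀).localFrame b' j ((extChartAt I' y₀).symm
        ((extChartAt I' y₀) y₀ + t • b' i + s • b' j))) 0) (W := fun s : ℝ ↦ (trivializationAt E'
        (TangentSpace I') y₀).localFrame b' i ((extChartAt I' y₀).symm ((extChartAt I' y₀) y₀ + (0
        : ℝ) • b' i + s • b' j))) (t₀ := 0) hVBNlift ((hWBNlift).comp 0 hcj)).deriv
  have hmem_i : ∀ᶠ t : ℝ in 𝓝 0, (extChartAt I' y₀) y₀ + t • b' i + (0 : ℝ) • b' j ∈ (extChartAt I'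
      y₀).target :=
    hℓi.continuousAt.preimage_mem_nhds ((isOpen_extChartAt_target y₀).mem_nhds hz00)
  have hmem_j : ∀ᶠ s : ℝ in 𝓝 0, (extChartAt I' y₀) y₀ + (0 : ℝ) • b' i + s • b' j ∈ (extChartAt I'
      y₀).target :=
    hℓj.continuousAt.preimage_mem_nhds ((isOpen_extChartAt_target y₀).mem_nhds hz00)
  have haff_s : ∀ t s : ℝ, (extChartAt I' y₀) y₀ + t • b' i + s • b' j = (extChartAt I' y₀) y₀ + t
      • b' i + (0 : ℝ) • b' j + s • b' j := fun t s ↦ by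
    simp only [zero_smul, add_zero]
  have haff_t : ∀ s t : ℝ, (extChartAt I' y₀) y₀ + t • b' i + s • b' j = (extChartAt I' y₀) y₀ + (0
      : ℝ) • b' i + s • b' j + t • b' i := fun s t ↦ by
    simp only [zero_smul, add_zero]; abel
  have h1 : deriv (fun t : ℝ ↦ g.val (f ((extChartAt I' y₀).symm ((extChartAt I' y₀) y₀ + t • b' i
      + (0 : ℝ) • b' j))) (covariantDerivAlong g.leviCivita (fun s : ℝ ↦ f ((extChartAt I' y₀).symm
      ((extChartAt I' y₀) y₀ + t • b' i + s • b' j))) (fun s ↦ mfderiv I' I f ((extChartAt I'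
      y₀).symm ((extChartAt I' y₀) y₀ + t • b' i + s • b' j)) ((trivializationAt E' (TangentSpace
      I') y₀).localFrame b' j ((extChartAt I' y₀).symm ((extChartAt I' y₀) y₀ + t • b' i + s • b'
      j)))) 0) (mfderiv I' I f ((extChartAt I' y₀).symm ((extChartAt I' y₀) y₀ + t • b' i + (0 : ℝ)
      • b' j)) ((trivializationAt E' (TangentSpace I') y₀).localFrame b' i ((extChartAt I' y₀).symm
      ((extChartAt I' y₀) y₀ + t • b' i + (0 : ℝ) • b' j))))) 0 = deriv (fun t : ℝ ↦
      (g.inducedMetric f hpb hfi).val ((extChartAt I' y₀).symm ((extChartAt I' y₀) y₀ + t • b' i +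
      (0 : ℝ) • b' j)) (covariantDerivAlong (g.inducedMetric f hpb hfi).leviCivita (fun s : ℝ ↦
      (extChartAt I' y₀).symm ((extChartAt I' y₀) y₀ + t • b' i + s • b' j)) (fun s ↦
      (trivializationAt E' (TangentSpace I') y₀).localFrame b' j ((extChartAt I' y₀).symm
      ((extChartAt I' y₀) y₀ + t • b' i + s • b' j))) 0) ((trivializationAt E' (TangentSpace I')
      y₀).localFrame b' i ((extChartAt I' y₀).symm ((extChartAt I' y₀) y₀ + t • b' i + (0 : ℝ) • b'
      j)))) 0 := by
    refine Filter.EventuallyEq.deriv_eq ?_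
    filter_upwards [hmem_i] with t ht
    exact val_covariantDerivAlong_mfderiv_localFrame_symm_comp₀ g hpb hfi b'
      (ℓ := fun s : ℝ ↦ (extChartAt I' y₀) y₀ + t • b' i + s • b' j) ht (haff_s t) j
          ((trivializationAt E' (TangentSpace I') y₀).localFrame b' i ((extChartAt I' y₀).symm
          ((extChartAt I' y₀) y₀ + t • b' i + (0 : ℝ) • b' j)))
  have h2 : deriv (fun s : ℝ ↦ g.val (f ((extChartAt I' y₀).symm ((extChartAt I' y₀) y₀ + (0 : ℝ) •
      b' i + s • b' j))) (covariantDerivAlong g.leviCivita (fun t : ℝ ↦ f ((extChartAt I' y₀).symm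
      ((extChartAt I' y₀) y₀ + t • b' i + s • b' j))) (fun t ↦ mfderiv I' I f ((extChartAt I'
      y₀).symm ((extChartAt I' y₀) y₀ + t • b' i + s • b' j)) ((trivializationAt E' (TangentSpace
      I') y₀).localFrame b' j ((extChartAt I' y₀).symm ((extChartAt I' y₀) y₀ + t • b' i + s • b'
      j)))) 0) (mfderiv I' I f ((extChartAt I' y₀).symm ((extChartAt I' y₀) y₀ + (0 : ℝ) • b' i + s
      • b' j)) ((trivializationAt E' (TangentSpace I') y₀).localFrame b' i ((extChartAt I' y₀).symm
      ((extChartAt I' y₀) y₀ + (0 : ℝ) • b' i + s • b' j))))) 0 = deriv (fun s : ℝ ↦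
      (g.inducedMetric f hpb hfi).val ((extChartAt I' y₀).symm ((extChartAt I' y₀) y₀ + (0 : ℝ) •
      b' i + s • b' j)) (covariantDerivAlong (g.inducedMetric f hpb hfi).leviCivita (fun t : ℝ ↦
      (extChartAt I' y₀).symm ((extChartAt I' y₀) y₀ + t • b' i + s • b' j)) (fun t ↦
      (trivializationAt E' (TangentSpace I') y₀).localFrame b' j ((extChartAt I' y₀).symm
      ((extChartAt I' y₀) y₀ + t • b' i + s • b' j))) 0) ((trivializationAt E' (TangentSpace I')
      y₀).localFrame b' i ((extChartAt I' y₀).symm ((extChartAt I' y₀) y₀ + (0 : ℝ) • b' i + s • b'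
      j)))) 0 := by
    refine Filter.EventuallyEq.deriv_eq ?_
    filter_upwards [hmem_j] with s hs
    exact val_covariantDerivAlong_mfderiv_localFrame_symm_comp₀ g hpb hfi b'
      (ℓ := fun t : ℝ ↦ (extChartAt I' y₀) y₀ + t • b' i + s • b' j) hs (haff_t s) j
          ((trivializationAt E' (TangentSpace I') y₀).localFrame b' i ((extChartAt I' y₀).symm
          ((extChartAt I' y₀) y₀ + (0 : ℝ) • b' i + s • b' j)))
  have hK' : MDiffAt (T% K) (f ((extChartAt I' y₀).symm ((extChartAt I' y₀) y₀ + (0 : ℝ) • b' i +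
      (0 : ℝ) • b' j))) := by rw [hq]; exact hK
  have hn' : ∀ᶠ y in 𝓝 ((extChartAt I' y₀).symm ((extChartAt I' y₀) y₀ + (0 : ℝ) • b' i + (0 : ℝ) •
      b' j)), ∀ u : TangentSpace I' y, g.val (f y) (K (f y)) (mfderiv I' I f y u) = 0 := by
    rw [hq]; exact hn
  have hK0' : ∀ u : TangentSpace I' ((extChartAt I' y₀).symm ((extChartAt I' y₀) y₀ + (0 : ℝ) • b' i
      + (0 : ℝ) • b' j)), g.val (f ((extChartAt I' y₀).symm ((extChartAt I' y₀) y₀ + (0 : ℝ) • b' i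
      + (0 : ℝ) • b' j))) (K (f ((extChartAt I' y₀).symm ((extChartAt I' y₀) y₀ + (0 : ℝ) • b' i +
      (0 : ℝ) • b' j)))) (mfderiv I' I f ((extChartAt I' y₀).symm ((extChartAt I' y₀) y₀ + (0 : ℝ) •
      b' i + (0 : ℝ) • b' j)) u) = 0 := hn'.self_of_nhds
  have hN0' : ∀ u : TangentSpace I' ((extChartAt I' y₀).symm ((extChartAt I' y₀) y₀ + (0 : ℝ) • b' i
      + (0 : ℝ) • b' j)), g.val (f ((extChartAt I' y₀).symm ((extChartAt I' y₀) y₀ + (0 : ℝ) • b' i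
      + (0 : ℝ) • b' j))) N₀ (mfderiv I' I f ((extChartAt I' y₀).symm ((extChartAt I' y₀) y₀ + (0 :
      ℝ) • b' i + (0 : ℝ) • b' j)) u) = 0 := by
    rw [hq]; exact hNorm0
  have hKK' : g.val (f ((extChartAt I' y₀).symm ((extChartAt I' y₀) y₀ + (0 : ℝ) • b' i + (0 : ℝ) •
      b' j))) (K (f ((extChartAt I' y₀).symm ((extChartAt I' y₀) y₀ + (0 : ℝ) • b' i + (0 : ℝ) •
      b' j)))) (K (f ((extChartAt I' y₀).symm ((extChartAt I' y₀) y₀ + (0 : ℝ) • b' i + (0 : ℝ) •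
      b' j)))) = 0 := by
    rw [hq]; exact hKK
  have hNN' : g.val (f ((extChartAt I' y₀).symm ((extChartAt I' y₀) y₀ + (0 : ℝ) • b' i + (0 : ℝ) •
      b' j))) N₀ N₀ = 0 := by
    rw [hq]; exact hNN
  have hKN' : g.val (f ((extChartAt I' y₀).symm ((extChartAt I' y₀) y₀ + (0 : ℝ) • b' i + (0 : ℝ) •
      b' j))) (K (f ((extChartAt I' y₀).symm ((extChartAt I' y₀) y₀ + (0 : ℝ) • b' i + (0 : ℝ) •
      b' j)))) N₀ ≠ 0 := by
    rw [hq]; exact hKN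
  have hB' : ∀ v w : TangentSpace I' ((extChartAt I' y₀).symm ((extChartAt I' y₀) y₀ + (0 : ℝ) • b'
      i + (0 : ℝ) • b' j)), g.val (f ((extChartAt I' y₀).symm ((extChartAt I' y₀) y₀ + (0 : ℝ) • b'
      i + (0 : ℝ) • b' j))) (g.leviCivita K (f ((extChartAt I' y₀).symm ((extChartAt I' y₀) y₀ + (0
      : ℝ) • b' i + (0 : ℝ) • b' j))) (mfderiv I' I f ((extChartAt I' y₀).symm ((extChartAt I' y₀)
      y₀ + (0 : ℝ) • b' i + (0 : ℝ) • b' j)) v)) (mfderiv I' I f ((extChartAt I' y₀).symm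
      ((extChartAt I' y₀) y₀ + (0 : ℝ) • b' i + (0 : ℝ) • b' j)) w) = 0 := by
    rw [hq]; exact hsff
  have t1 := fun u ↦ val_covariantDerivAlong_mfderiv_localFrame_symm_comp₀ g hpb hfi b'
    (ℓ := fun s : ℝ ↦ (extChartAt I' y₀) y₀ + (0 : ℝ) • b' i + s • b' j) hz00 (haff_s 0) j u
  have t2 := fun u ↦ val_covariantDerivAlong_mfderiv_localFrame_symm_comp₀ g hpb hfi b'
    (ℓ := fun t : ℝ ↦ (extChartAt I' y₀) y₀ + t • b' i + (0 : ℝ) • b' j) hz00 (haff_t 0) i u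
  have t3 := fun u ↦ val_covariantDerivAlong_mfderiv_localFrame_symm_comp₀ g hpb hfi b'
    (ℓ := fun t : ℝ ↦ (extChartAt I' y₀) y₀ + t • b' i + (0 : ℝ) • b' j) hz00 (haff_t 0) j u
  have t4 := fun u ↦ val_covariantDerivAlong_mfderiv_localFrame_symm_comp₀ g hpb hfi b'
    (ℓ := fun s : ℝ ↦ (extChartAt I' y₀) y₀ + (0 : ℝ) • b' i + s • b' j) hz00 (haff_s 0) i u
  have n1 := val_covariantDerivAlong_mfderiv_localFrame_nullNormal₀ g b' hf2
    (ℓ := fun s : ℝ ↦ (extChartAt I' y₀) y₀ + (0 : ℝ) • b' i + s • b' j) hz00 (haff_s 0) j hK' hn'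
  have n2 := val_covariantDerivAlong_mfderiv_localFrame_nullNormal₀ g b' hf2
    (ℓ := fun t : ℝ ↦ (extChartAt I' y₀) y₀ + t • b' i + (0 : ℝ) • b' j) hz00 (haff_t 0) i hK' hn'
  have n3 := val_covariantDerivAlong_mfderiv_localFrame_nullNormal₀ g b' hf2
    (ℓ := fun t : ℝ ↦ (extChartAt I' y₀) y₀ + t • b' i + (0 : ℝ) • b' j) hz00 (haff_t 0) j hK' hn'
  have n4 := val_covariantDerivAlong_mfderiv_localFrame_nullNormal₀ g b' hf2
    (ℓ := fun s : ℝ ↦ (extChartAt I' y₀) y₀ + (0 : ℝ) • b' i + s • b' j) hz00 (haff_s 0) i hK' hn'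
  have hP1 := val_eq_inducedMetric_add_nullPair g hpb hfi hK0' hN0' hKK' hNN' rfl hKN' hdim t1 t2
  have hP2 := val_eq_inducedMetric_add_nullPair g hpb hfi hK0' hN0' hKK' hNN' rfl hKN' hdim t3 t4
  rw [n1, n2, hB', hB', neg_zero, mul_zero, zero_mul, add_zero, zero_div, add_zero] at hP1
  rw [n3, n4, hB', hB', neg_zero, mul_zero, zero_mul, add_zero, zero_div, add_zero] at hP2
  have key : (g.inducedMetric f hpb hfi).val ((extChartAt I' y₀).symm ((extChartAt I' y₀) y₀ + (0 :
      ℝ) • b' i + (0 : ℝ) • b' j)) ((g.inducedMetric f hpb hfi).leviCivita.curvature ((extChartAt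
      I' y₀).symm ((extChartAt I' y₀) y₀ + (0 : ℝ) • b' i + (0 : ℝ) • b' j)) ((trivializationAt E'
      (TangentSpace I') y₀).localFrame b' i ((extChartAt I' y₀).symm ((extChartAt I' y₀) y₀ + (0 :
      ℝ) • b' i + (0 : ℝ) • b' j))) ((trivializationAt E' (TangentSpace I') y₀).localFrame b' j
      ((extChartAt I' y₀).symm ((extChartAt I' y₀) y₀ + (0 : ℝ) • b' i + (0 : ℝ) • b' j)))
      ((trivializationAt E' (TangentSpace I') y₀).localFrame b' j ((extChartAt I' y₀).symm
      ((extChartAt I' y₀) y₀ + (0 : ℝ) • b' i + (0 : ℝ) • b' j)))) ((trivializationAt E'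
      (TangentSpace I') y₀).localFrame b' i ((extChartAt I' y₀).symm ((extChartAt I' y₀) y₀ + (0 :
      ℝ) • b' i + (0 : ℝ) • b' j))) =
      g.val (f ((extChartAt I' y₀).symm ((extChartAt I' y₀) y₀ + (0 : ℝ) • b' i + (0 : ℝ) • b' j)))
          (g.leviCivita.curvature (f ((extChartAt I' y₀).symm ((extChartAt I' y₀) y₀ + (0 : ℝ) • b'
          i + (0 : ℝ) • b' j))) (mfderiv I' I f ((extChartAt I' y₀).symm ((extChartAt I' y₀) y₀ +
          (0 : ℝ) • b' i + (0 : ℝ) • b' j)) ((trivializationAt E' (TangentSpace I') y₀).localFrame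
          b' i ((extChartAt I' y₀).symm ((extChartAt I' y₀) y₀ + (0 : ℝ) • b' i + (0 : ℝ) • b'
          j)))) (mfderiv I' I f ((extChartAt I' y₀).symm ((extChartAt I' y₀) y₀ + (0 : ℝ) • b' i +
          (0 : ℝ) • b' j)) ((trivializationAt E' (TangentSpace I') y₀).localFrame b' j ((extChartAt
          I' y₀).symm ((extChartAt I' y₀) y₀ + (0 : ℝ) • b' i + (0 : ℝ) • b' j)))) (mfderiv I' I f
          ((extChartAt I' y₀).symm ((extChartAt I' y₀) y₀ + (0 : ℝ) • b' i + (0 : ℝ) • b' j))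
          ((trivializationAt E' (TangentSpace I') y₀).localFrame b' j ((extChartAt I' y₀).symm
          ((extChartAt I' y₀) y₀ + (0 : ℝ) • b' i + (0 : ℝ) • b' j))))) (mfderiv I' I f
          ((extChartAt I' y₀).symm ((extChartAt I' y₀) y₀ + (0 : ℝ) • b' i + (0 : ℝ) • b' j))
          ((trivializationAt E' (TangentSpace I') y₀).localFrame b' i ((extChartAt I' y₀).symm
          ((extChartAt I' y₀) y₀ + (0 : ℝ) • b' i + (0 : ℝ) • b' j)))) := by
    linarith [hM, hA, hB, h1, h2, hN, hAN, hBN, hP1, hP2]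
  rw [hq] at key
  exact key
end Gauss

/-- **Registered sub-goal form of the null Gauss equation on a coordinate pair** (crux 17840). -/
theorem stub_nh_gaussNullFrame : ∀ (M : Type) [TopologicalSpace M] [ChartedSpace E4 M] [IsManifold (𝓡 4) ∞ M] (g : PseudoRiemannianMetric (𝓡 4) ∞ E4 (TangentSpace (𝓡 4) : M → Type _)) [g.HasLeviCivita] (S : Type) [TopologicalSpace S] [ChartedSpace (EuclideanSpace ℝ (Fin 2)) S] [IsManifold (𝓡 2) ∞ S] (f : S → M) (hfi : g.IsSpacelikeImmersion (𝓡 2) f) (K : Π x : M, TangentSpace (𝓡 4) x) (b' : Module.Basis (Fin 2) ℝ (EuclideanSpace ℝ (Fin 2))) (y₀ : S) (N₀ : TangentSpace (𝓡 4) (f y₀)), MDifferentiableAt (𝓡 4) (𝓡 4).tangent (fun x ↦ (Bundle.TotalSpace.mk' E4 x (K x) : TangentBundle (𝓡 4) M)) (f y₀) → (∀ᶠ y in 𝓝 y₀, ∀ u : TangentSpace (𝓡 2) y, g.val (f y) (K (f y)) (mfderiv (𝓡 2) (𝓡 4) f y u) = 0) → g.val (f y₀) (K (f y₀)) (K (f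 y₀)) = 0 → g.val (f y₀) N₀ N₀ = 0 → g.val (f y₀) (K (f y₀)) N₀ ≠ 0 → (∀ u : TangentSpace (𝓡 2) y₀, g.val (f y₀) N₀ (mfderiv (𝓡 2) (𝓡 4) f y₀ u) = 0) → (∀ v w : TangentSpace (𝓡 2) y₀, g.val (f y₀) (g.leviCivita K (f y₀) (mfderiv (𝓡 2) (𝓡 4) f y₀ v)) (mfderiv (𝓡 2) (𝓡 4) f y₀ w) = 0) → ∀ (i j : Fin 2) [(g.inducedMetric f PseudoRiemannianMetric.contMDiff_pullbackBilin_holds hfi).HasLeviCivita], (g.inducedMetric f PseudoRiemannianMetric.contMDiff_pullbackBilin_holds hfi).val y₀ ((g.inducedMetric f PseudoRiemannianMetric.contMDiff_pullbackBilin_holds hfi).riemann y₀ ((trivializationAt (EuclideanSpace ℝ (Fin 2)) (TangentSpace (𝓡 2)) y₀).localFrame b' i y₀) ((trivializationAt (EuclideanSpace ℝ (Fin 2)) (TangentSpace (𝓡 2)) y₀).localFrame b' j y₀) ((trivializationAt (EuclideanSpace ℝ (Fin 2)) (TangentSpace (𝓡 2)) y₀).localFrame b' j y₀)) ((trivializationAt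 (EuclideanSpace ℝ (Fin 2)) (TangentSpace (𝓡 2)) y₀).localFrame b' i y₀) = g.val (f y₀) (g.riemann (f y₀) (mfderiv (𝓡 2) (𝓡 4) f y₀ ((trivializationAt (EuclideanSpace ℝ (Fin 2)) (TangentSpace (𝓡 2)) y₀).localFrame b' i y₀)) (mfderiv (𝓡 2) (𝓡 4) f y₀ ((trivializationAt (EuclideanSpace ℝ (Fin 2)) (TangentSpace (𝓡 2)) y₀).localFrame b' j y₀)) (mfderiv (𝓡 2) (𝓡 4) f y₀ ((trivializationAt (EuclideanSpace ℝ (Fin 2)) (TangentSpace (𝓡 2)) y₀).localFrame b' j y₀))) (mfderiv (𝓡 2) (𝓡 4) f y₀ ((trivializationAt (EuclideanSpace ℝ (Fin 2)) (TangentSpace (𝓡 2)) y₀).localFrame b' i y₀)) := by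
  intro M _ _ _ g _ S _ _ _ f hfi K b' y₀ N₀ hK hn hKK hNN hKN hN0 hB i j _
  have hdim : Module.finrank ℝ E4 = Module.finrank ℝ (EuclideanSpace ℝ (Fin 2)) + 2 := by
    rw [finrank_euclideanSpace_fin, finrank_euclideanSpace_fin]
  exact gauss_equation_null_localFrame g PseudoRiemannianMetric.contMDiff_pullbackBilin_holds hfi b'
    hK hn hKK hNN hKN hN0 hB hdim i j

end Summit.FinalStateConjecture.FinalStateConjecture.Theorems.HawkingExtensionIsKerr.SketchIdeator2

end
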